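import Summits.QuantumFields.YangMills.Theorems.UnitScaleTiltProp8ChartDoubleBarBall
import Summits.QuantumFields.YangMills.Theorems.UnitScaleTiltProp8ChartDoubleBarAccumulated
import Literature.MathematicalPhysics.QuantumFieldTheory.Balaban1983to89.B9Eq335PlaquettesOfRegularCubeZd
import HarnessLib

/-!
# Route `UnitScaleTilt`, crux K1 «MinimiserStabilityRegPr» (stmt-QuantumFields-19200), registered stub `stub_halvingStep` (H), road (M2′)+(N1) of LEAD-H WORD 10 —
# brick **(N3) «THE ACCUMULATED FRAMES ARE NEAR `1`»**: a k-UNIFORM SIZE ROW for the accumulated block frames (97) `ν_k = v(U̿^{(0)})·v(U̿^{(1)})·…·v(U̿^{(k−1)})`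
# of the double-bar tower ([Balaban1985Averaging] (89), (92), (97)–(100), (110))

Cell `ym3-torus` (HUMAN RULING D-0037: YM₃ on T³ is ladder rung R3 — NOT d = 4, NOT a mass gap, NOT the Clay problem), width seat `ym3-torus-px3` gen 5.
`--supports stmt-QuantumFields-19200 --as helper`; THEOREMS ONLY (0 `def`, 0 `sorry`, standard axioms); count-neutral; nothing here claims B-al, the (b)-row,
(M2′), `hSupU`, the stub, the crux or the gap.

WHY.  The double-bar tower `dbarIterU k W` IS the single-bar tower `emlIterU k W` gauge-transformed by the inverse ACCUMULATED FRAMES `ν_k` (print's (92)∕(99),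
✓`Prop8ChartDoubleBar.dbarIterU_eq_gaugeActT_emlIterU`; the frames are produced by the recursion (97) `ν₀ = 1`, `ν_{i+1}(y) = ν_i(ȳ)·v(U̿^{(i)}W)(y)`, ✓`exists_accFrames_dbarIterU`,
and the H door carries exactly this recursion as its rows `hν0`∕`hνs`, ✓`HalvingP1FlatCoreSupplierTowers.exists_nuTower`).  The tree propagates PREDICATES along that recursion
(✓`HalvingCompetitorMapFrames.accFrames_pred_of_small`: unitarity, `det = 1`) but had no quantitative row `‖ν_k(y) − 1‖ ≤ …`.  LEAD-H ★w5-19200 g7 WORD 10 (2) ∕ WORD 17 name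
«(N3) frames `ν_k = 1 + O(·)`» as one of the S–M bricks of the (b)-side of the (M2′) assembly at the member (with LEMMA B-al and (N2)); ym-ust-20520-w3 g9's LOCATE «B-al-3 ∕
(b-ROW) CONSUMER SIDE» §1 reads the (b)-quantity as `a(y) = Ξ(y₀)·v₀(y)·Ξ(y)⁻¹` with `Ξ := ν_k⁻¹·(ŭ₁⁻¹ ∘ emb^k)·(ĝJ ∘ emb^k)`.  THIS FILE is the engine row for `ν_k`, k-UNIFORM
(geometric in the level, top-dominated), in letters already fixed by the door, with the per-level inputs in the CALLER's currency.

WHAT IS PROVED (namespace `…Theorems.Prop8ChartDoubleBarAccFrameSize`; generic complete normed `ℂ`-algebra `𝔸` (`‖1‖ = 1` from §3 on); any `P : Params`; any family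
`ν : (i : ℕ) → Site P i → 𝔸ˣ` obeying the recursion VERBATIM — no `def`).
* §1 `norm_accFrame_succ_sub_one_le` (via lit ✓`B9Eq335PlaquettesOfRegularCubeZd.one_add_norm_mul_sub_one_le`) — ONE STEP of (97): `‖ν_{i+1}(y) − 1‖ ≤ a + f + a·f` from
  `‖ν_i(ȳ) − 1‖ ≤ a` and `‖v(U̿^{(i)}W)(y) − 1‖ ≤ f`.
* §2 ★★ `one_add_norm_accFrames_sub_one_le_exp` ∕ `norm_accFrames_sub_one_le_of_levelSizes` — PER-LEVEL form on a nested family of territories `S i` (`emb`-closed downwards):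
  if `‖U̿^{(i)}W(b) − 1‖ ≤ σ_i` on the block-internal level-`i` bonds under `S (i+1)` and `600ℓσ_i ≤ 1` (`ℓ = (d+2)L`) for `i < k`, then
  `‖ν_k(y) − 1‖ ≤ exp(2ℓ·Σ_{i<k} σ_i) − 1` on `S k` (✓`norm_vframeU_sub_one_le`: each frame within `2ℓσ_i`; `1 + t ≤ e^t`).  The `σ_i` are the CALLER's (global `2Lⁱs₀`, or the
  (F3)-local sizes of ★w3-19200 g10's memo 67606d20) — the row serves either reading of the (b)-side.
* §3 ★★ `norm_accFrames_sub_one_le_of_reads` — READS form: on a family `S i` closed under `emb` downwards AND under blocks (`blockOf z ∈ S (i+1) → z ∈ S i`), a fine `𝔸ˣ`-field `W`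
  with `‖W(b) − 1‖ ≤ s₀` on the fine bonds with both ends in `S 0` and the budget `30400·ℓ²·Lᵏ·s₀ ≤ 1` has `‖ν_k(y) − 1‖ ≤ 16(d+2)·(Lᵏs₀)` on `S k` — §2 at `σ_i := 2Lⁱs₀`
  (✓`norm_dbarIterU_sub_one_le_two_mul₀`, the B1∕B2 near-flatness of the double-bar tower with `C₁ = 3800` plugged) and the geometric sum `Σ_{i<k} Lⁱ ≤ Lᵏ∕(L−1) ≤ 2Lᵏ∕L`,
  `e^x − 1 ≤ 2x` (`0 ≤ x ≤ 1`).  The constant `16(d+2)` multiplies the TOP smallness `Lᵏs₀` only: no `k`.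
* §4 `norm_mul_inv_sub_one_le_of_norm_inv_le_one`, ★ `norm_accFrames_rel_sub_one_le_of_reads` — the two-site RELATIVE row `‖ν_k(y)·ν_k(y₀)⁻¹ − 1‖ ≤ 2·16(d+2)·(Lᵏs₀)` when
  `‖ν_k(y₀)⁻¹‖ ≤ 1` (the unitary case, ✓`HalvingCompetitorMapFramesSU2.su2_vframeU_dbarIterU` at the member) — the shape `Ξ(y₀)·…·Ξ(y)⁻¹` of the (b)-row reads.
CURRENCY (honest, ym-ust-20520-w3 g9 §2): read at the u₁-FREE field `X̂ = ĝJ•U♭` the row is `O((d+2)·s_top)` POINTWISE in the global window and `O(d²L·ε₀)`-class with (F3)-local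
`σ_i` (§2); read at `Ŵ = ŭ₁⁻¹•X̂` it is `c′`-class — the exact u₁-cancellation ((B-al-4)) is the consumer's job, not this row's.
HONEST SCOPE.  Elementary bookkeeping over landed engine rows; no covariance, no SU(2); nothing of B-al-1∕2∕3∕4, (N2), the (b)-row or the stub is proved here.

References: T. Bałaban, CMP **98** (1985) 17–51 [Balaban1985Averaging] ((62) p.28, (89) p.31, (92) p.31, (97)–(100) p.32, (110) p.34, Prop. 3 (122)–(125) p.36,
Prop. 4 (134)–(135) p.38); CMP **109** (1987) 249–301 [Balaban1987RG1] ((0.3)–(0.6) pp.252–253).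
-/

set_option autoImplicit false

noncomputable section

open scoped BigOperators
open NormedSpace

namespace Summit.QuantumFields.YangMills.Theorems.Prop8ChartDoubleBarAccFrameSize

open Literature.MathematicalPhysics.QuantumFieldTheory.Balaban1983to89
open T4Continuum BlockAveraging
open B5Eq118OneStroke (iterBlockOf iterBlockOf_succ iterBlockOf_zero)
open Summit.QuantumFields.YangMills.Theorems.Prop8ChartDoubleBar (vframeU dbarIterU norm_vframeU_sub_one_le norm_dbarIterU_sub_one_le_two_mul₀)
open B9Eq335PlaquettesOfRegularCubeZd (one_add_norm_mul_sub_one_le)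

variable {P : Params}
variable {𝔸 : Type*} [NormedRing 𝔸] [NormedAlgebra ℂ 𝔸] [CompleteSpace 𝔸]

/-! ## §1 One step of the recursion (97) -/

omit [NormedAlgebra ℂ 𝔸] [CompleteSpace 𝔸] in
/-- **ONE STEP OF (97)**: `‖ν_{i+1}(y) − 1‖ ≤ a + f + a·f` whenever `ν_{i+1}(y) = ν_i(ȳ)·v` with `‖ν_i(ȳ) − 1‖ ≤ a`, `‖v − 1‖ ≤ f`.
[cite: Balaban1985Averaging, (97) p.32, (110) p.34] -/
theorem norm_accFrame_succ_sub_one_le {νe v νy : 𝔸ˣ} (hrec : νy = νe * v) {a f : ℝ}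
    (ha : ‖((νe : 𝔸ˣ) : 𝔸) - 1‖ ≤ a) (hf : ‖((v : 𝔸ˣ) : 𝔸) - 1‖ ≤ f) :
    ‖((νy : 𝔸ˣ) : 𝔸) - 1‖ ≤ a + f + a * f := by
  rw [hrec, Units.val_mul]
  have h := one_add_norm_mul_sub_one_le ((νe : 𝔸ˣ) : 𝔸) ((v : 𝔸ˣ) : 𝔸)
  have ha0 : 0 ≤ a := (norm_nonneg _).trans ha
  have hf0 : 0 ≤ f := (norm_nonneg _).trans hf
  have hprod : (1 + ‖((νe : 𝔸ˣ) : 𝔸) - 1‖) * (1 + ‖((v : 𝔸ˣ) : 𝔸) - 1‖) ≤ (1 + a) * (1 + f) :=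
    mul_le_mul (by linarith) (by linarith) (by positivity) (by linarith)
  nlinarith

/-! ## §2 The per-level form on a nested family of territories -/

variable [NormOneClass 𝔸]

/-- ★★ **THE ACCUMULATED FRAMES, PER-LEVEL SIZES**: for the recursion (97) (`hν0`, `hνs` VERBATIM as the H door carries them), a family of territories `S i` with `emb y ∈ S i`
for `y ∈ S (i+1)`, and per-level sizes `σ_i` of the double-bar field `U̿^{(i)}W` on the block-internal level-`i` bonds under `S (i+1)` (`600ℓσ_i ≤ 1`), the accumulated frame at
every `y ∈ S k` satisfies `1 + ‖ν_k(y) − 1‖ ≤ exp(2ℓ·Σ_{i<k} σ_i)` — each block frame is within `2ℓσ_i` of `1` (✓`norm_vframeU_sub_one_le`) and `1 + t ≤ e^t`.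
[cite: Balaban1985Averaging, (97)-(100) p.32, (110) p.34, (62) p.28] -/
theorem one_add_norm_accFrames_sub_one_le_exp (W : GaugeField P 0 𝔸ˣ) (ν : (i : ℕ) → Site P i → 𝔸ˣ) (hν0 : ∀ s, ν 0 s = 1)
    (hνs : ∀ (i : ℕ) (y : Site P (i + 1)), ν (i + 1) y = ν i (emb y) * vframeU (dbarIterU i W) y)
    {k : ℕ} (hk : k ≤ P.m + P.K) (S : (i : ℕ) → Set (Site P i)) (hemb : ∀ i, i < k → ∀ y ∈ S (i + 1), emb y ∈ S i)
    (σ : ℕ → ℝ) (hσ0 : ∀ i, i < k → 0 ≤ σ i) (hσ : ∀ i, i < k → 600 * (((P.d + 2) * P.L : ℕ) : ℝ) * σ i ≤ 1)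
    (hD : ∀ i, i < k → ∀ y ∈ S (i + 1), ∀ b : PBond P i, blockOf b.src = y → blockOf b.tgt = y →
      ‖((dbarIterU i W b : 𝔸ˣ) : 𝔸) - 1‖ ≤ σ i) :
    ∀ y ∈ S k, 1 + ‖((ν k y : 𝔸ˣ) : 𝔸) - 1‖ ≤ Real.exp (2 * (((P.d + 2) * P.L : ℕ) : ℝ) * ∑ i ∈ Finset.range k, σ i) := by
  set ℓ : ℝ := (((P.d + 2) * P.L : ℕ) : ℝ) with hℓ
  have hℓ0 : 0 ≤ ℓ := Nat.cast_nonneg _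
  induction k with
  | zero =>
    intro y _
    rw [hν0 y, Units.val_one, sub_self, norm_zero, add_zero, Finset.sum_range_zero, mul_zero, Real.exp_zero]
  | succ k ih =>
    intro y hy
    have hk' : k ≤ P.m + P.K := Nat.le_of_succ_le hk
    have ih' := ih hk' (fun i hi => hemb i (Nat.lt_succ_of_lt hi)) (fun i hi => hσ0 i (Nat.lt_succ_of_lt hi))
      (fun i hi => hD i (Nat.lt_succ_of_lt hi)) (fun i hi => hσ i (Nat.lt_succ_of_lt hi)) (emb y) (hemb k (Nat.lt_succ_self k) y hy)
    -- the frame at level `k`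
    have hkk : k < k + 1 := Nat.lt_succ_self k
    have hf : ‖((vframeU (dbarIterU k W) y : 𝔸ˣ) : 𝔸) - 1‖ ≤ 2 * ℓ * σ k :=
      norm_vframeU_sub_one_le hk y (hσ0 k hkk) (hσ k hkk) (fun b hs ht => hD k hkk y hy b hs ht)
    have hstep := one_add_norm_mul_sub_one_le ((ν k (emb y) : 𝔸ˣ) : 𝔸) ((vframeU (dbarIterU k W) y : 𝔸ˣ) : 𝔸)
    rw [hνs k y, Units.val_mul]
    have h1 : 0 ≤ 1 + ‖((ν k (emb y) : 𝔸ˣ) : 𝔸) - 1‖ := by positivity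
    have h2 : 1 + ‖((vframeU (dbarIterU k W) y : 𝔸ˣ) : 𝔸) - 1‖ ≤ Real.exp (2 * ℓ * σ k) := by
      calc _ ≤ 1 + 2 * ℓ * σ k := by linarith
        _ ≤ Real.exp (2 * ℓ * σ k) := by have := Real.add_one_le_exp (2 * ℓ * σ k); linarith
    calc _ ≤ (1 + ‖((ν k (emb y) : 𝔸ˣ) : 𝔸) - 1‖) * (1 + ‖((vframeU (dbarIterU k W) y : 𝔸ˣ) : 𝔸) - 1‖) := hstep
      _ ≤ Real.exp (2 * ℓ * ∑ i ∈ Finset.range k, σ i) * Real.exp (2 * ℓ * σ k) :=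
          mul_le_mul ih' h2 (by positivity) (Real.exp_pos _).le
      _ = Real.exp (2 * ℓ * ∑ i ∈ Finset.range (k + 1), σ i) := by
          rw [← Real.exp_add, Finset.sum_range_succ]; ring_nf

/-- ★★ **(N3), PER-LEVEL FORM**: under the hypotheses of `one_add_norm_accFrames_sub_one_le_exp`, `‖ν_k(y) − 1‖ ≤ exp(2ℓ·Σ_{i<k} σ_i) − 1` on `S k`.
[cite: Balaban1985Averaging, (97)-(100) p.32, (110) p.34] -/
theorem norm_accFrames_sub_one_le_of_levelSizes (W : GaugeField P 0 𝔸ˣ) (ν : (i : ℕ) → Site P i → 𝔸ˣ) (hν0 : ∀ s, ν 0 s = 1)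
    (hνs : ∀ (i : ℕ) (y : Site P (i + 1)), ν (i + 1) y = ν i (emb y) * vframeU (dbarIterU i W) y)
    {k : ℕ} (hk : k ≤ P.m + P.K) (S : (i : ℕ) → Set (Site P i)) (hemb : ∀ i, i < k → ∀ y ∈ S (i + 1), emb y ∈ S i)
    (σ : ℕ → ℝ) (hσ0 : ∀ i, i < k → 0 ≤ σ i) (hσ : ∀ i, i < k → 600 * (((P.d + 2) * P.L : ℕ) : ℝ) * σ i ≤ 1)
    (hD : ∀ i, i < k → ∀ y ∈ S (i + 1), ∀ b : PBond P i, blockOf b.src = y → blockOf b.tgt = y →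
      ‖((dbarIterU i W b : 𝔸ˣ) : 𝔸) - 1‖ ≤ σ i)
    (y : Site P k) (hy : y ∈ S k) :
    ‖((ν k y : 𝔸ˣ) : 𝔸) - 1‖ ≤ Real.exp (2 * (((P.d + 2) * P.L : ℕ) : ℝ) * ∑ i ∈ Finset.range k, σ i) - 1 := by
  have h := one_add_norm_accFrames_sub_one_le_exp W ν hν0 hνs hk S hemb σ hσ0 hσ hD y hy
  linarith

/-! ## §3 The reads form: `‖ν_k − 1‖ ≤ 16(d+2)·Lᵏs₀` -/

/-- Block-closure of the territories iterates down to level `0`: if `blockOf z ∈ S (i+1) → z ∈ S i` for all `i < k`, then `iterBlockOf i x ∈ S i → x ∈ S 0` for `i ≤ k`.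
[cite: Balaban1987RG1, (0.3) p.252] (bookkeeping) -/
theorem mem_zero_of_iterBlockOf_mem (S : (i : ℕ) → Set (Site P i)) {k : ℕ} (hblk : ∀ i, i < k → ∀ z : Site P i, blockOf z ∈ S (i + 1) → z ∈ S i) :
    ∀ i, i ≤ k → ∀ x : Site P 0, iterBlockOf i x ∈ S i → x ∈ S 0
  | 0, _, x, hx => by simpa [iterBlockOf_zero] using hx
  | i + 1, hi, x, hx => by
    refine mem_zero_of_iterBlockOf_mem S hblk i (Nat.le_of_succ_le hi) x ?_
    rw [iterBlockOf_succ] at hx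
    exact hblk i (Nat.lt_of_succ_le hi) _ hx

/-- ★★ **(N3), READS FORM — THE ACCUMULATED FRAMES ARE WITHIN `16(d+2)·Lᵏs₀` OF `1`, k-UNIFORMLY**: for the recursion (97) (`hν0`∕`hνs`), a family of territories `S i` closed
DOWNWARDS under `emb` (`y ∈ S (i+1) → emb y ∈ S i`) and under blocks (`blockOf z ∈ S (i+1) → z ∈ S i`), a fine `𝔸ˣ`-field `W` within `s₀` of `1` on the fine bonds with both
ends in `S 0`, and the budget `30400·ℓ²·Lᵏ·s₀ ≤ 1` (`ℓ = (d+2)L`; `30400 = 8·3800`, the budget of ✓`norm_dbarIterU_sub_one_le_two_mul₀`): `‖ν_k(y) − 1‖ ≤ 16(d+2)·(Lᵏs₀)`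
on `S k` — the constant multiplies the TOP smallness only (`Σ_{i<k} 2ℓ·2Lⁱs₀ ≤ 8ℓLᵏs₀∕L = 8(d+2)Lᵏs₀ =: x ≤ 1`, `e^x − 1 ≤ 2x`).
[cite: Balaban1985Averaging, (97)-(100) p.32, (110) p.34, Prop. 4 (134)-(135) p.38] -/
theorem norm_accFrames_sub_one_le_of_reads (W : GaugeField P 0 𝔸ˣ) (ν : (i : ℕ) → Site P i → 𝔸ˣ) (hν0 : ∀ s, ν 0 s = 1)
    (hνs : ∀ (i : ℕ) (y : Site P (i + 1)), ν (i + 1) y = ν i (emb y) * vframeU (dbarIterU i W) y)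
    {k : ℕ} (hk : k ≤ P.m + P.K) (S : (i : ℕ) → Set (Site P i)) (hemb : ∀ i, i < k → ∀ y ∈ S (i + 1), emb y ∈ S i)
    (hblk : ∀ i, i < k → ∀ z : Site P i, blockOf z ∈ S (i + 1) → z ∈ S i)
    {s₀ : ℝ} (hs₀ : 0 ≤ s₀) (hbudget : 30400 * (((P.d + 2) * P.L : ℕ) : ℝ) ^ 2 * (P.L : ℝ) ^ k * s₀ ≤ 1)
    (hW : ∀ b : PBond P 0, b.src ∈ S 0 → b.tgt ∈ S 0 → ‖((W b : 𝔸ˣ) : 𝔸) - 1‖ ≤ s₀)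
    (y : Site P k) (hy : y ∈ S k) :
    ‖((ν k y : 𝔸ˣ) : 𝔸) - 1‖ ≤ 16 * ((P.d : ℝ) + 2) * ((P.L : ℝ) ^ k * s₀) := by
  set ℓ : ℝ := (((P.d + 2) * P.L : ℕ) : ℝ) with hℓ
  have hL2 : (2 : ℝ) ≤ P.L := by exact_mod_cast P.hL.2
  have hL0 : (0 : ℝ) < P.L := by linarith
  have hℓL : ℓ = ((P.d : ℝ) + 2) * P.L := by rw [hℓ]; push_cast; ring
  have hℓ4 : (4 : ℝ) ≤ ℓ := by rw [hℓL]; nlinarith [show (0 : ℝ) ≤ P.d from Nat.cast_nonneg _]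
  have hℓ0 : (0 : ℝ) ≤ ℓ := by linarith
  have hLk1 : (1 : ℝ) ≤ (P.L : ℝ) ^ k := one_le_pow₀ (by linarith)
  -- per-level sizes `σ i := 2·Lⁱ·s₀`
  set σ : ℕ → ℝ := fun i => 2 * ((P.L : ℝ) ^ i * s₀) with hσdef
  have hσ0 : ∀ i, i < k → 0 ≤ σ i := fun i _ => by positivity
  -- the budgets at the lower levels follow from the top budget
  have hpow_le : ∀ i, i < k → (P.L : ℝ) ^ i ≤ (P.L : ℝ) ^ k := fun i hi => pow_le_pow_right₀ (by linarith) hi.le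
  have hbud_i : ∀ i, i < k → 8 * 3800 * ℓ ^ 2 * (P.L : ℝ) ^ i * s₀ ≤ 1 := by
    intro i hi
    have h1 : 8 * 3800 * ℓ ^ 2 * (P.L : ℝ) ^ i * s₀ ≤ 8 * 3800 * ℓ ^ 2 * (P.L : ℝ) ^ k * s₀ :=
      mul_le_mul_of_nonneg_right (mul_le_mul_of_nonneg_left (hpow_le i hi) (by positivity)) hs₀
    linarith
  have hσ : ∀ i, i < k → 600 * ℓ * σ i ≤ 1 := by
    intro i hi
    -- `1200ℓ·Lⁱs₀ ≤ 30400ℓ²·Lᵏs₀ ≤ 1` since `ℓ ≥ 4`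
    have h1 : 600 * ℓ * σ i = 1200 * ℓ * ((P.L : ℝ) ^ i * s₀) := by rw [hσdef]; ring
    have h2 : (P.L : ℝ) ^ i * s₀ ≤ (P.L : ℝ) ^ k * s₀ := mul_le_mul_of_nonneg_right (hpow_le i hi) hs₀
    have h3 : 0 ≤ (P.L : ℝ) ^ k * s₀ := by positivity
    have h4 : 1200 * ℓ ≤ 30400 * ℓ ^ 2 := by nlinarith
    have h5 : 30400 * ℓ ^ 2 * (P.L : ℝ) ^ k * s₀ = 30400 * ℓ ^ 2 * ((P.L : ℝ) ^ k * s₀) := by ring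
    rw [h1]
    nlinarith [mul_le_mul h4 h2 (by positivity) (by positivity)]
  -- the fine field is small under every `S i`
  have hW_i : ∀ i, i ≤ k → ∀ b : PBond P 0, iterBlockOf i b.src ∈ S i → iterBlockOf i b.tgt ∈ S i → ‖((W b : 𝔸ˣ) : 𝔸) - 1‖ ≤ s₀ := by
    intro i hi b hs ht
    have hblk' : ∀ i', i' < i → ∀ z : Site P i', blockOf z ∈ S (i' + 1) → z ∈ S i' := fun i' hi' => hblk i' (lt_of_lt_of_le hi' hi)
    exact hW b (mem_zero_of_iterBlockOf_mem S hblk' i le_rfl _ hs) (mem_zero_of_iterBlockOf_mem S hblk' i le_rfl _ ht)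
  -- the double-bar fields are within `σ i` on the block-internal bonds under `S (i+1)`
  have hD : ∀ i, i < k → ∀ y ∈ S (i + 1), ∀ b : PBond P i, blockOf b.src = y → blockOf b.tgt = y →
      ‖((dbarIterU i W b : 𝔸ˣ) : 𝔸) - 1‖ ≤ σ i := by
    intro i hi y hy b hs ht
    have hi' : i ≤ P.m + P.K := by omega
    exact norm_dbarIterU_sub_one_le_two_mul₀ hi' (S i) W hs₀ (by rw [hℓ] at hbud_i; exact hbud_i i hi) (hW_i i hi.le) b
      (hblk i hi _ (by rw [hs]; exact hy)) (hblk i hi _ (by rw [ht]; exact hy))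
  have hmain := one_add_norm_accFrames_sub_one_le_exp W ν hν0 hνs hk S hemb σ hσ0 (by rw [hℓ] at hσ; exact hσ) hD y hy
  -- the exponent: `2ℓ·Σ 2Lⁱs₀ ≤ 8ℓ·Lᵏs₀∕L = 8(d+2)·Lᵏs₀ =: x ≤ 1`
  set x : ℝ := 8 * ((P.d : ℝ) + 2) * ((P.L : ℝ) ^ k * s₀) with hx
  have hx0 : 0 ≤ x := by positivity
  have hsum : ∑ i ∈ Finset.range k, σ i = 2 * s₀ * ∑ i ∈ Finset.range k, (P.L : ℝ) ^ i := by
    rw [hσdef, Finset.mul_sum]; refine Finset.sum_congr rfl fun i _ => by ring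
  have hexp_le : 2 * ℓ * ∑ i ∈ Finset.range k, σ i ≤ x := by
    rw [hsum]
    -- the geometric sum `Σ_{i<k} Lⁱ ≤ 2Lᵏ∕L` (`(Lᵏ − 1)∕(L − 1) ≤ Lᵏ∕(L − 1)`, `L∕(L − 1) ≤ 2`; ✓`DressedLegUnits.geom_sum_le_of_two_le`'s arithmetic, inlined)
    have hg : ∑ i ∈ Finset.range k, (P.L : ℝ) ^ i ≤ 2 * (P.L : ℝ) ^ k / P.L := by
      have hgeom : (∑ i ∈ Finset.range k, (P.L : ℝ) ^ i) * ((P.L : ℝ) - 1) = (P.L : ℝ) ^ k - 1 := geom_sum_mul _ k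
      have hpow : (0 : ℝ) ≤ (P.L : ℝ) ^ k := by positivity
      rw [le_div_iff₀ hL0]
      nlinarith [hgeom, hpow]
    have h1 : 2 * ℓ * (2 * s₀ * ∑ i ∈ Finset.range k, (P.L : ℝ) ^ i) ≤ 2 * ℓ * (2 * s₀ * (2 * (P.L : ℝ) ^ k / P.L)) :=
      mul_le_mul_of_nonneg_left (mul_le_mul_of_nonneg_left hg (by positivity)) (by positivity)
    have h2 : 2 * ℓ * (2 * s₀ * (2 * (P.L : ℝ) ^ k / P.L)) = x := by
      rw [hx, hℓL]; field_simp; ring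
    linarith
  have hx1 : x ≤ 1 := by
    -- `8(d+2)·Lᵏs₀ ≤ 30400ℓ²·Lᵏs₀ ≤ 1`
    have h3 : 0 ≤ (P.L : ℝ) ^ k * s₀ := by positivity
    have hd2 : (P.d : ℝ) + 2 ≤ ℓ := by rw [hℓL]; nlinarith [show (0 : ℝ) ≤ P.d from Nat.cast_nonneg _]
    have h4 : 8 * ((P.d : ℝ) + 2) ≤ 30400 * ℓ ^ 2 := by nlinarith
    have h5 : 30400 * ℓ ^ 2 * (P.L : ℝ) ^ k * s₀ = 30400 * ℓ ^ 2 * ((P.L : ℝ) ^ k * s₀) := by ring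
    rw [hx]; nlinarith [mul_le_mul_of_nonneg_right h4 h3]
  have hexp : Real.exp (2 * ℓ * ∑ i ∈ Finset.range k, σ i) ≤ Real.exp x := Real.exp_le_exp.mpr hexp_le
  have hex1 : Real.exp x - 1 ≤ 2 * x := by
    have h := Real.abs_exp_sub_one_le (x := x) (by rw [abs_of_nonneg hx0]; exact hx1)
    rw [abs_of_nonneg hx0] at h
    exact (le_abs_self _).trans h
  have hfin : ‖((ν k y : 𝔸ˣ) : 𝔸) - 1‖ ≤ Real.exp x - 1 := by rw [hℓ] at hexp; linarith
  calc _ ≤ 2 * x := hfin.trans hex1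
    _ = 16 * ((P.d : ℝ) + 2) * ((P.L : ℝ) ^ k * s₀) := by rw [hx]; ring

/-! ## §4 The two-site relative row -/

omit [NormedAlgebra ℂ 𝔸] [CompleteSpace 𝔸] [NormOneClass 𝔸] in
/-- `‖a·b⁻¹ − 1‖ ≤ ‖a − 1‖ + ‖b − 1‖` when `‖b⁻¹‖ ≤ 1` (`a b⁻¹ − 1 = (a − b)·b⁻¹`). [folklore] -/
theorem norm_mul_inv_sub_one_le_of_norm_inv_le_one (a b : 𝔸ˣ) (hb : ‖((b⁻¹ : 𝔸ˣ) : 𝔸)‖ ≤ 1) :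
    ‖((a : 𝔸ˣ) : 𝔸) * ((b⁻¹ : 𝔸ˣ) : 𝔸) - 1‖ ≤ ‖((a : 𝔸ˣ) : 𝔸) - 1‖ + ‖((b : 𝔸ˣ) : 𝔸) - 1‖ := by
  have e : ((a : 𝔸ˣ) : 𝔸) * ((b⁻¹ : 𝔸ˣ) : 𝔸) - 1 = (((a : 𝔸ˣ) : 𝔸) - (b : 𝔸)) * ((b⁻¹ : 𝔸ˣ) : 𝔸) := by
    rw [sub_mul, Units.mul_inv]
  rw [e]
  calc _ ≤ ‖((a : 𝔸ˣ) : 𝔸) - (b : 𝔸)‖ * ‖((b⁻¹ : 𝔸ˣ) : 𝔸)‖ := norm_mul_le _ _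
    _ ≤ ‖((a : 𝔸ˣ) : 𝔸) - (b : 𝔸)‖ * 1 := mul_le_mul_of_nonneg_left hb (norm_nonneg _)
    _ ≤ ‖((a : 𝔸ˣ) : 𝔸) - 1‖ + ‖((b : 𝔸ˣ) : 𝔸) - 1‖ := by
        rw [mul_one]
        have e2 : ((a : 𝔸ˣ) : 𝔸) - (b : 𝔸) = (((a : 𝔸ˣ) : 𝔸) - 1) - (((b : 𝔸ˣ) : 𝔸) - 1) := by abel
        rw [e2]; exact norm_sub_le _ _

/-- ★ **THE TWO-SITE RELATIVE ROW**: under the hypotheses of `norm_accFrames_sub_one_le_of_reads` and `‖ν_k(y₀)⁻¹‖ ≤ 1` (the unitary case at the member), for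
`y, y₀ ∈ S k`: `‖ν_k(y)·ν_k(y₀)⁻¹ − 1‖ ≤ 2·16(d+2)·(Lᵏs₀)` — the shape in which the (b)-row `Ξ(y₀)·v₀(y)·Ξ(y)⁻¹` reads the frames.
[cite: Balaban1985Averaging, (97)-(100) p.32, (92) p.31] -/
theorem norm_accFrames_rel_sub_one_le_of_reads (W : GaugeField P 0 𝔸ˣ) (ν : (i : ℕ) → Site P i → 𝔸ˣ) (hν0 : ∀ s, ν 0 s = 1)
    (hνs : ∀ (i : ℕ) (y : Site P (i + 1)), ν (i + 1) y = ν i (emb y) * vframeU (dbarIterU i W) y)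
    {k : ℕ} (hk : k ≤ P.m + P.K) (S : (i : ℕ) → Set (Site P i)) (hemb : ∀ i, i < k → ∀ y ∈ S (i + 1), emb y ∈ S i)
    (hblk : ∀ i, i < k → ∀ z : Site P i, blockOf z ∈ S (i + 1) → z ∈ S i)
    {s₀ : ℝ} (hs₀ : 0 ≤ s₀) (hbudget : 30400 * (((P.d + 2) * P.L : ℕ) : ℝ) ^ 2 * (P.L : ℝ) ^ k * s₀ ≤ 1)
    (hW : ∀ b : PBond P 0, b.src ∈ S 0 → b.tgt ∈ S 0 → ‖((W b : 𝔸ˣ) : 𝔸) - 1‖ ≤ s₀)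
    (y y₀ : Site P k) (hy : y ∈ S k) (hy₀ : y₀ ∈ S k) (hinv : ‖(((ν k y₀)⁻¹ : 𝔸ˣ) : 𝔸)‖ ≤ 1) :
    ‖((ν k y : 𝔸ˣ) : 𝔸) * (((ν k y₀)⁻¹ : 𝔸ˣ) : 𝔸) - 1‖ ≤ 2 * (16 * ((P.d : ℝ) + 2) * ((P.L : ℝ) ^ k * s₀)) := by
  have h1 := norm_accFrames_sub_one_le_of_reads W ν hν0 hνs hk S hemb hblk hs₀ hbudget hW y hy
  have h2 := norm_accFrames_sub_one_le_of_reads W ν hν0 hνs hk S hemb hblk hs₀ hbudget hW y₀ hy₀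
  have h3 := norm_mul_inv_sub_one_le_of_norm_inv_le_one (ν k y) (ν k y₀) hinv
  linarith

end Summit.QuantumFields.YangMills.Theorems.Prop8ChartDoubleBarAccFrameSize

end
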